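import Literature.Computability.Cryptography.LWEGuessTestProg
import Literature.Computability.Cryptography.LWERateGuessTest
import HarnessLib

/-!
# The h₃ machine's rate-guess test, III: the flat layout and the verdict agree with the law-level test

Topic `Computability/Cryptography` (LWE), grouping namespace `BLPRS2013.KProg`; sequel of `LWEGuessTestProg.lean` (`blockOf`, `cntOf`, `tVerdictOf`:
the list-level layout, window counts and gap test of the machine) and bridge to `LWERateGuessTest.lean` (`LWE.blocksOf` twice, `LWE.MP12.cnt`, `GapAt`,
`gapSet`: the law-level ones). Pure list/`Fin` plumbing and arithmetic (everything PROVED; one definition with body, `bitsOf`; no named fact):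

* **`blockOf_ofFn`** — the machine's block `(w, i)` of the item list of a flat tuple `S` is the item list of `blocksOf N m (blocksOf G (N·m) S w) i`;
* `bitsOf` (the answer family `(rows, reference)` read off a flat answer list), `cntOf_ofFn_row`, `cntOf_ofFn_ref` (window counts are `cnt`),
  **`tVerdictOf_ofFn`** — the machine's verdict on the flat answers is `decide (bitsOf … ∈ gapSet N N' (1/T))` (`θ = 1/T`, integer test
  `N·N' < T·|N'·cnt_w − N·cnt_ref|`).

## References

* Z. Brakerski, A. Langlois, C. Peikert, O. Regev, D. Stehlé, *Classical hardness of learning with errors*, STOC 2013; arXiv:1306.0281,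
  Lemma 2.15 (proof sketch). [BrakerskiEtAl2013]
-/

noncomputable section

namespace Literature.Computability.Cryptography

namespace BLPRS2013

namespace KProg

open LWE LWE.MP12 LWE.MP12.Prog

/-! ### Blocks -/

/-- `drop`/`take` a window of an `ofFn`. [folklore] -/
theorem take_drop_ofFn {α : Type*} {M : ℕ} (f : Fin M → α) (off len : ℕ) (h : off + len ≤ M) :
    ((List.ofFn f).drop off).take len = List.ofFn fun k : Fin len => f ⟨off + k, by omega⟩ := by
  apply List.ext_getElem
  · simp; omega
  · intro k h₁ h₂
    simp

/-- **The machine's block `(w, i)` is the law-level block.** [cite: BrakerskiEtAl2013, Lemma 2.15] -/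
theorem blockOf_ofFn {α : Type} {G N m : ℕ} (S : Fin (G * (N * m)) → α) (g : α → LItem) (w : Fin G) (i : Fin N) :
    blockOf N m (List.ofFn fun j => g (S j)) w i = List.ofFn fun k => g (blocksOf N m (blocksOf G (N * m) S w) i k) := by
  have hwi : (w : ℕ) * (N * m) + i * m + m ≤ G * (N * m) := by
    have h1 : (i : ℕ) * m + m ≤ N * m := by nlinarith [i.2]
    have h2 : ((w : ℕ) + 1) * (N * m) ≤ G * (N * m) := Nat.mul_le_mul_right _ w.2
    nlinarith
  unfold blockOf
  rw [take_drop_ofFn _ _ _ hwi]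
  congr 1
  funext k
  congr 1
  unfold blocksOf
  congr 1
  apply Fin.ext
  rw [val_finProdFinEquiv, val_finProdFinEquiv]
  simp only
  ring

/-! ### Counts and the verdict -/

section Verdict

variable {G N N' : ℕ}

/-- The flat index of row `w`, batch `i`: `w·N + i`. [folklore] -/
def rowIdx (w : Fin G) (i : Fin N) : Fin (G * N + N') :=
  ⟨w * N + i, by nlinarith [w.2, i.2]⟩

/-- The flat index of reference run `i`: `G·N + i`. [folklore] -/
def refIdx (i : Fin N') : Fin (G * N + N') :=
  ⟨G * N + i, by omega⟩

/-- Values of the row index. [folklore] -/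
@[simp] theorem val_rowIdx (w : Fin G) (i : Fin N) : ((rowIdx w i : Fin (G * N + N')) : ℕ) = w * N + i := rfl

/-- Values of the reference index. [folklore] -/
@[simp] theorem val_refIdx (i : Fin N') : ((refIdx i : Fin (G * N + N')) : ℕ) = G * N + i := rfl

/-- **The answer family read off the flat answer list**: rows `b (w·N + i)`, reference `b (G·N + i')`. [cite: BrakerskiEtAl2013, Lemma 2.15 (proof sketch)] -/
def bitsOf (b : Fin (G * N + N') → Bool) : (Fin G → Fin N → Bool) × (Fin N' → Bool) :=
  (fun w i => b (rowIdx w i), fun i => b (refIdx i))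

/-- Counting `true` in an `ofFn` is the real count `cnt`. [folklore] -/
theorem count_ofFn_eq_cnt {M : ℕ} (f : Fin M → Bool) : (((List.ofFn f).count true : ℕ) : ℝ) = cnt f := by
  induction M with
  | zero => simp [cnt]
  | succ M ih =>
    have h := ih (fun k => f k.succ)
    rw [cnt] at h
    rw [List.ofFn_succ, List.count_cons, cnt, Fin.sum_univ_succ]
    push_cast
    rw [h]
    cases f 0 <;> simp [add_comm]

/-- **Row window count = `cnt` of the row.** [folklore] -/
theorem cntOf_ofFn_row (b : Fin (G * N + N') → Bool) (w : Fin G) :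
    ((cntOf (List.ofFn b) (w * N) N : ℕ) : ℝ) = cnt ((bitsOf b).1 w) := by
  unfold cntOf
  rw [take_drop_ofFn b (w * N) N (by nlinarith [w.2]), count_ofFn_eq_cnt]
  rfl

/-- **Reference window count = `cnt` of the reference.** [folklore] -/
theorem cntOf_ofFn_ref (b : Fin (G * N + N') → Bool) :
    ((cntOf (List.ofFn b) (G * N) N' : ℕ) : ℝ) = cnt (bitsOf b).2 := by
  unfold cntOf
  rw [take_drop_ofFn b (G * N) N' le_rfl, count_ofFn_eq_cnt]
  rfl

/-- The integer gap test is `GapAt` with `θ = 1/T` (`T ≥ 1`). [cite: BrakerskiEtAl2013, Lemma 2.15 (proof sketch)] -/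
theorem gapTest_iff {T : ℕ} (hT : 0 < T) (b : Fin (G * N + N') → Bool) (w : Fin G) :
    N * N' < T * ((N' : ℤ) * (cntOf (List.ofFn b) (w * N) N : ℤ) - (N : ℤ) * (cntOf (List.ofFn b) (G * N) N' : ℤ)).natAbs ↔
      GapAt N N' (1 / (T : ℝ)) (bitsOf b) w := by
  unfold GapAt
  rw [← cntOf_ofFn_row, ← cntOf_ofFn_ref]
  have hT' : (0 : ℝ) < T := by exact_mod_cast hT
  -- cast the integer test to `ℝ`
  have key : (N * N' < T * ((N' : ℤ) * (cntOf (List.ofFn b) (w * N) N : ℤ) - (N : ℤ) * (cntOf (List.ofFn b) (G * N) N' : ℤ)).natAbs) ↔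
      ((N : ℝ) * N' < T * |(N' : ℝ) * (cntOf (List.ofFn b) (w * N) N : ℕ) - N * (cntOf (List.ofFn b) (G * N) N' : ℕ)|) := by
    have e : (((N' : ℤ) * (cntOf (List.ofFn b) (w * N) N : ℤ) - (N : ℤ) * (cntOf (List.ofFn b) (G * N) N' : ℤ)).natAbs : ℝ) =
        |(N' : ℝ) * (cntOf (List.ofFn b) (w * N) N : ℕ) - N * (cntOf (List.ofFn b) (G * N) N' : ℕ)| := by
      rw [Nat.cast_natAbs, Int.cast_abs]
      push_cast
      ring_nf
    constructor
    · intro h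
      have h' : ((N * N' : ℕ) : ℝ) < ((T * ((N' : ℤ) * (cntOf (List.ofFn b) (w * N) N : ℤ) - (N : ℤ) * (cntOf (List.ofFn b) (G * N) N' : ℤ)).natAbs : ℕ) : ℝ) := by
        exact_mod_cast h
      push_cast at h'
      rwa [e] at h'
    · intro h
      rw [← e] at h
      have h' : ((N * N' : ℕ) : ℝ) < ((T * ((N' : ℤ) * (cntOf (List.ofFn b) (w * N) N : ℤ) - (N : ℤ) * (cntOf (List.ofFn b) (G * N) N' : ℤ)).natAbs : ℕ) : ℝ) := by
        push_cast; exact h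
      exact_mod_cast h'
  rw [key]
  rw [show (N : ℝ) * N' * (1 / T) = (N : ℝ) * N' / T by ring, div_lt_iff₀ hT']
  constructor
  · intro h; linarith
  · intro h; linarith

open Classical in
/-- **The machine's verdict is the law-level gap event** (`θ = 1/T`): on a record with `G, N, N', T` at their fields,
`tVerdictOf r (ofFn b) = decide (bitsOf b ∈ gapSet N N' (1/T))`. [cite: BrakerskiEtAl2013, Lemma 2.15 (proof sketch)] -/
theorem tVerdictOf_ofFn (r : TRec) (hG : r.nG = G) (hN : r.nN = N) (hN' : r.nN' = N') {T : ℕ} (hT : r.tt = T) (hT0 : 0 < T)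
    (b : Fin (G * N + N') → Bool) :
    tVerdictOf r (List.ofFn b) = decide (bitsOf b ∈ gapSet N N' (1 / (T : ℝ))) := by
  unfold tVerdictOf
  rw [hG, hN, hN', hT]
  rw [Bool.eq_iff_iff, List.any_eq_true, decide_eq_true_iff]
  simp only [gapSet, Set.mem_setOf_eq]
  constructor
  · rintro ⟨w, hw, h⟩
    rw [List.mem_range] at hw
    exact ⟨⟨w, hw⟩, (gapTest_iff hT0 b ⟨w, hw⟩).1 (of_decide_eq_true h)⟩
  · rintro ⟨w, hw⟩
    exact ⟨w, List.mem_range.2 w.2, decide_eq_true ((gapTest_iff hT0 b w).2 hw)⟩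

end Verdict

end KProg

end BLPRS2013

end Literature.Computability.Cryptography

end
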